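import Summits.QuantumFields.YangMills.Theorems.UnitScaleTiltProp7OneFormPointwiseDecay
import Summits.QuantumFields.YangMills.Theorems.UnitScaleTiltProp7OneFormCoshFamily
import Summits.QuantumFields.YangMills.Theorems.UnitScaleTiltProp7OneFormDecayData
import HarnessLib

/-!
# Route `UnitScaleTilt`, crux K1 «MinimiserStabilityRegPr» (stmt-QuantumFields-19200), EX face S46 — (L3′b), ONE-FORM STOREY, FILE O4-KNIT:
# **THE POINTWISE DECAY OF THE ONE-FORM GREEN's FUNCTION WITH THE WEIGHT FAMILY DISCHARGED** — O4 ✓`pointwiseDecay_oneForm_of_letters` run on O4b ✓`exists_coshFamily` (rate `κ ≤ r`,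
# `λ ≥ 1∕2`), with O4c ✓`norm_le_mul_exp_neg_of_support` (`hf`) and ✓`sqrt_sum_normSq_div_weight_le_of_blockDecay` (`hEW`, two-rate); what remains displayed is ONLY the block-supported
# bounded source, the `L²` BLOCK DECAY of the solution (A4's shape) and the decayed remainder letter `hqdom` (px16 g13's (O4-loc) ∘ O4e shape), at r-only constants

Cell `ym3-torus` (HUMAN RULING D-0037; rung R3 = SU(2) YM₃ on T³ — NOT d = 4, NOT infinite volume, NOT a mass gap, NOT Clay).  Chair seat ★`ym-ust-19200-p1` g26, own pen O4-KNIT.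
THEOREMS ONLY (0 `def`, 0 `sorry`, default heartbeats); `--supports stmt-QuantumFields-19200 --as helper`; count-neutral.

WHAT IS PROVED (ns `Summit.QuantumFields.YangMills.Theorems.Prop7OneFormPointwiseDecayKnit`).
* `sum_range_three_inv_pow_le` — `Σ_{l<3}(1∕λ)^l ≤ 7` for `λ ≥ 1∕2`.
* ★★★ `pointwiseDecay_oneForm_knit` — for every background∕slot∕coupling, `Δ_a u = f` with `f` supported on the bonds of ONE block `v` and `|f| ≤ F`, the block decay
  `‖1_y u‖ ≤ D₀e^{−r·tdist(y,v)}` (`r > 0`) and the remainder letter `‖q(p)‖ ≤ (s_D + θ·S_{κ₁})e^{−κ₁d(p)}` for all rates `0 ≤ κ₁ ≤ r`, and `θ·(8e^{3r})·14 < 1`: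
  `∃ κ₁ ∈ (0, r]`, `∀ p₀`, `‖u(p₀)‖ ≤ A_r·e^{−κ₁·tdist(B(p₀), v)}` with the r-ONLY constant
  `A_r = ((F + s_D)·(8e^{3r})·14 + √(3³·8∕(c₀ℓ³))·√(8e^{3r}·(2(1+1∕r))³)·D₀) ∕ (1 − θ·(8e^{3r})·14)` — NO weight, rate or supersolution letter left.
HONEST SCOPE.  Assembly of landed files; CONDITIONAL on the three displayed data letters; nothing of the ten EX rows, `hT`, (3.42) for print's operators, EX or the crux is proved here.

References: T. Bałaban, CMP **99** (1985) 389–434 [Balaban1985BackgroundPropagators] (Thm 3.1 (3.42) p.397, (3.46) p.398, Thm 3.12 p.422); CMP **95** (1984) 17–40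
[Balaban1984PropagatorsI] (Prop. 1.1 p.33, p.36).
-/

set_option autoImplicit false

noncomputable section

open scoped Matrix.Norms.L2Operator BigOperators InnerProductSpace ComplexConjugate

namespace Summit.QuantumFields.YangMills.Theorems.Prop7OneFormPointwiseDecayKnit

open Literature.MathematicalPhysics.QuantumFieldTheory.Balaban1983to89
open Literature.MathematicalPhysics.QuantumFieldTheory.Balaban1983to89.T3ContinuumYM3Torus
open T3SectALandauChart (formComp bgUnits eta eta_pos)
open B4Sect5Torus (TSite)
open B9SectCLatticeCarrier (Bond shift unshift)
open B9Eq311L2Pairing (WL2)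
open B9TorusCalculus (torusT)
open B9Eq310Hermitian (deltaPrimeOp)
open B11Eq135Weitzenbock (curvOp)
open B11Eq103H1Complex (BondL2K)
open B5Eq118OneStroke (iterBlockOf)
open B3Taylor310LocalRemainder (tdist_self)
open Summit.QuantumFields.YangMills.Theorems.Prop7SectET3Transport (periodsT3 siteEquiv bondEquiv)
open Summit.QuantumFields.YangMills.Theorems.Prop7SectET3HilbertLetters (W₂ frobEquiv toL2 DL2 DstarL2)
open Summit.QuantumFields.YangMills.Theorems.Prop7SectET3WilsonHessian (DeltaEta)
open Summit.QuantumFields.YangMills.Theorems.Prop7SectET3GaugeProjector (RS)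
open Summit.QuantumFields.YangMills.Theorems.Prop7SectET3CurvedPropagators (laplaceA Qk)
open Summit.QuantumFields.YangMills.Theorems.Prop7OneFormPointwiseDecay (pointwiseDecay_oneForm_of_letters)
open Summit.QuantumFields.YangMills.Theorems.Prop7OneFormCoshFamily (exists_coshFamily)
open Summit.QuantumFields.YangMills.Theorems.Prop7OneFormDecayData (norm_le_mul_exp_neg_of_support sqrt_sum_normSq_div_weight_le_of_blockDecay)

/-- `Σ_{l<3}(1∕λ)^l = 1 + 1∕λ + 1∕λ² ≤ 7` for `λ ≥ 1∕2`. [folklore] -/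
theorem sum_range_three_inv_pow_le {lam : ℝ} (hlam : (1 : ℝ) / 2 ≤ lam) : ∑ l ∈ Finset.range 3, (1 / lam) ^ l ≤ 7 := by
  have hlam0 : 0 < lam := by linarith
  have h1 : 1 / lam ≤ 2 := by rw [div_le_iff₀ hlam0]; linarith
  have h0 : 0 ≤ 1 / lam := by positivity
  simp only [Finset.sum_range_succ, Finset.sum_range_zero, pow_zero, pow_one, zero_add]
  nlinarith

variable {F : T3Family} {n K : ℕ} {c₀ : ℝ} [Fact (0 < c₀)] {h : n ≤ K} {cB a : ℝ} [Fact (0 < cB)]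
  {Δx : GaugeField (F.P K) 0 (Matrix.specialUnitaryGroup (Fin 2) ℂ) → (BondL2K ℂ 3 (periodsT3 F K) c₀ W₂ →ₗ[ℂ] BondL2K ℂ 3 (periodsT3 F K) c₀ W₂)}

set_option maxHeartbeats 400000 in
/-- ★★★ **THE POINTWISE DECAY OF THE ONE-FORM GREEN's FUNCTION, WEIGHTS DISCHARGED.**  `Δ_a(U₀)u = f` (ANY background, slot, coupling), `q` the O1∕O2 remainder (O3d's text); the source
`f` is supported on the bonds whose source lies in the block `v` and `|f| ≤ F`; the solution has the `L²` BLOCK DECAY `‖1_y u‖ ≤ D₀·e^{−r·tdist(y,v)}` (`r > 0`, A4's shape); the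
remainder obeys `‖q(p)‖ ≤ (s_D + θ·⨆_{p′}‖u(p′)‖e^{κ₁d(p′)})·e^{−κ₁d(p)}` for EVERY rate `0 ≤ κ₁ ≤ r` (`d(p) = tdist(B(p₋), v)`; (O4-loc) + O4e); and `θ·(8e^{3r})·14 < 1`.  THEN there is
a rate `0 < κ₁ ≤ r` with `‖u(p₀)‖ ≤ A_r·e^{−κ₁·d(p₀)}` at EVERY bond, `A_r = ((F + s_D)·(8e^{3r})·14 + √(3³·8∕(c₀ℓ³))·√(8e^{3r}(2(1+1∕r))³)·D₀)∕(1 − θ·(8e^{3r})·14)` —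
O4 on O4b's cosh family (`κ ≤ r`, `λ ≥ 1∕2`, `C_g = 8e^{3κ}`, floor `(1∕8)e^{−3κ}`), `κ₁ = κ∕2`, `hf` by O4c §1, `hEW` by O4c §2 (two-rate, `κ < 2r`).  CONDITIONAL on the three data letters.
HEARTBEATS (disclosed): measured by px16 g13 — fails at 100k, passes at 130k; the decl-local budget below keeps a ≥ 3× margin (cell rule), the mathematics is unaffected.
[cite: Balaban1985BackgroundPropagators, Thm 3.1 (3.42) p.397, (3.46) p.398, Thm 3.12 p.422; Balaban1984PropagatorsI, Prop. 1.1 p.33] -/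
theorem pointwiseDecay_oneForm_knit (hnK : n ≤ K) (U₀ : GaugeField (F.P K) 0 (Matrix.specialUnitaryGroup (Fin 2) ℂ))
    {u f : BondL2K ℂ 3 (periodsT3 F K) c₀ W₂} (hu : laplaceA F n K h c₀ cB a Δx U₀ u = f)
    {q : Bond 3 (periodsT3 F K) → W₂}
    (hq : ∀ p, q p = WL2.equiv ℂ _ W₂ (LinearMap.adjoint (Qk F n K h c₀ cB U₀) (((a : ℝ) : ℂ) • Qk F n K h c₀ cB U₀ u)) p
      - WL2.equiv ℂ _ W₂ (DL2 F n K c₀ U₀ (DstarL2 F n K c₀ U₀ u - RS F n K h c₀ cB U₀ (DstarL2 F n K c₀ U₀ u))) p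
      + WL2.equiv ℂ _ W₂ ((Δx U₀ - (DeltaEta F n K c₀ U₀ : BondL2K ℂ 3 (periodsT3 F K) c₀ W₂ →ₗ[ℂ] BondL2K ℂ 3 (periodsT3 F K) c₀ W₂)) u) p
      + frobEquiv.symm ((eta F n K)⁻¹ • (eta F n K)⁻¹ •
          (deltaPrimeOp (torusT (F.P K) 0) (fun ν x => bgUnits F K U₀ ⟨x, ν⟩) 1 (formComp ((toL2 F K c₀).symm u)) p.2 ((siteEquiv F K).symm p.1)
            - curvOp (torusT (F.P K) 0) (fun ν x => bgUnits F K U₀ ⟨x, ν⟩) (formComp ((toL2 F K c₀).symm u)) p.2 ((siteEquiv F K).symm p.1))))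
    (v : Site (F.P K) (K - n)) {Fsrc : ℝ} (hfb : ∀ p, ‖WL2.equiv ℂ _ W₂ f p‖ ≤ Fsrc)
    (hfs : ∀ p, WL2.equiv ℂ _ W₂ f p ≠ 0 → iterBlockOf (K - n) ((bondEquiv F K).symm p).src = v)
    {r D₀ : ℝ} (hr : 0 < r) (hD₀ : 0 ≤ D₀)
    (hD : ∀ y : Site (F.P K) (K - n),
      ‖toL2 F K c₀ (fun b => if iterBlockOf (K - n) b.src = y then (toL2 F K c₀).symm u b else 0)‖ ≤ D₀ * Real.exp (-(r * (Site.tdist y v : ℝ))))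
    {sD θ : ℝ} (hsD : 0 ≤ sD) (hθ : 0 ≤ θ)
    (hqdom : ∀ κ₁ : ℝ, 0 ≤ κ₁ → κ₁ ≤ r → ∀ p, ‖q p‖
      ≤ (sD + θ * ⨆ p', ‖WL2.equiv ℂ _ W₂ u p'‖ * Real.exp (κ₁ * (Site.tdist (iterBlockOf (K - n) ((bondEquiv F K).symm p').src) v : ℝ)))
          * Real.exp (-(κ₁ * (Site.tdist (iterBlockOf (K - n) ((bondEquiv F K).symm p).src) v : ℝ))))
    (hsmall : θ * (8 * Real.exp (3 * r)) * 14 < 1) :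
    ∃ κ₁ : ℝ, 0 < κ₁ ∧ κ₁ ≤ r ∧ ∀ p₀ : Bond 3 (periodsT3 F K),
      ‖WL2.equiv ℂ _ W₂ u p₀‖
        ≤ (((Fsrc + sD) * (8 * Real.exp (3 * r)) * 14
              + Real.sqrt (3 ^ 3 * 8 / (c₀ * ((F.L : ℝ) ^ (K - n)) ^ 3)) * (Real.sqrt (8 * Real.exp (3 * r) * (2 * (1 + 1 / r)) ^ 3) * D₀))
            / (1 - θ * (8 * Real.exp (3 * r)) * 14))
          * Real.exp (-(κ₁ * (Site.tdist (iterBlockOf (K - n) ((bondEquiv F K).symm p₀).src) v : ℝ))) := by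
  have hc₀ : 0 < c₀ := Fact.out
  -- the cosh family at rate `≤ r`
  obtain ⟨κ, lam, W, hκ0, hκr, hlam, hWpos, hsup, hW1, hfloor, hgrowth⟩ := exists_coshFamily F n K hnK hr v
  have hlam0 : 0 < lam := by linarith
  set d : Bond 3 (periodsT3 F K) → ℝ := fun p => (Site.tdist (iterBlockOf (K - n) ((bondEquiv F K).symm p).src) v : ℝ) with hd
  set κ₁ : ℝ := κ / 2 with hκ₁
  have hκ₁0 : 0 < κ₁ := by positivity
  have hκ₁κ : κ₁ ≤ κ := by rw [hκ₁]; linarith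
  have hκ₁r : κ₁ ≤ r := hκ₁κ.trans hκr
  refine ⟨κ₁, hκ₁0, hκ₁r, fun p₀ => ?_⟩
  -- the letters of O4
  have hFsrc : 0 ≤ Fsrc := (norm_nonneg _).trans (hfb p₀)
  have hf' : ∀ p, ‖WL2.equiv ℂ _ W₂ f p‖ ≤ Fsrc * Real.exp (-(κ₁ * d p)) :=
    norm_le_mul_exp_neg_of_support (fun p => WL2.equiv ℂ _ W₂ f p) d κ₁ hfb fun p hp => by
      show (Site.tdist (iterBlockOf (K - n) ((bondEquiv F K).symm p).src) v : ℝ) = 0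
      rw [hfs p hp, tdist_self]; simp
  have hWd : ∀ p₁ p, Real.exp (κ₁ * d p₁) ≤ (8 * Real.exp (3 * κ)) * Real.exp (κ₁ * d p) * W p₁ p := hgrowth κ₁ hκ₁0.le hκ₁κ
  set EW : ℝ := Real.sqrt ((1 / 8 * Real.exp (-(3 * κ)))⁻¹ * (2 * (1 + 1 / (2 * r - κ))) ^ 3) * D₀ with hEWdef
  have hEW0 : 0 ≤ EW := by positivity
  have hEW : ∀ p₁, Real.sqrt (∑ p, c₀ * ‖WL2.equiv ℂ _ W₂ u p‖ ^ 2 / W p₁ p) ≤ EW * Real.exp (-(κ₁ * d p₁)) := by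
    intro p₁
    have h2r : κ < 2 * r := by linarith
    exact sqrt_sum_normSq_div_weight_le_of_blockDecay (n := n) u (W p₁) (iterBlockOf (K - n) ((bondEquiv F K).symm p₁).src) v
      hκ0.le (by positivity) hD₀ h2r (hfloor p₁) hD
  have hqdom' := hqdom κ₁ hκ₁0.le hκ₁r
  -- the smallness at the family's constants
  have hS7 : ∑ l ∈ Finset.range 3, (1 / lam) ^ l ≤ 7 := sum_range_three_inv_pow_le hlam
  have hS0 : 0 ≤ ∑ l ∈ Finset.range 3, (1 / lam) ^ l := Finset.sum_nonneg fun l _ => by positivity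
  have hCg_le : 8 * Real.exp (3 * κ) ≤ 8 * Real.exp (3 * r) := by
    have := Real.exp_le_exp.mpr (by linarith : 3 * κ ≤ 3 * r); linarith
  have hSl : (∑ l ∈ Finset.range 3, (1 / lam) ^ l) / lam ≤ 14 := by
    rw [div_le_iff₀ hlam0]; nlinarith
  have hprod_le : θ * (8 * Real.exp (3 * κ)) * (∑ l ∈ Finset.range 3, (1 / lam) ^ l) / lam ≤ θ * (8 * Real.exp (3 * r)) * 14 := by
    rw [mul_div_assoc]
    exact mul_le_mul (mul_le_mul_of_nonneg_left hCg_le hθ) hSl (by positivity) (by positivity)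
  have hsmall' : θ * (8 * Real.exp (3 * κ)) * (∑ l ∈ Finset.range 3, (1 / lam) ^ l) / lam < 1 := hprod_le.trans_lt hsmall
  -- O4
  have hO4 := pointwiseDecay_oneForm_of_letters (h := h) (cB := cB) (a := a) (Δx := Δx) hnK U₀ hu hq d κ₁ W hlam0 hWpos hsup hW1
    (by positivity : (0 : ℝ) ≤ 8 * Real.exp (3 * κ)) hWd hFsrc hsD hθ hEW0 hf' hqdom' hEW hsmall' p₀
  refine hO4.trans (mul_le_mul_of_nonneg_right ?_ (Real.exp_pos _).le)
  -- compare the constants: numerators up, denominators down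
  have hden : 0 < 1 - θ * (8 * Real.exp (3 * r)) * 14 := by linarith
  have hden' : 1 - θ * (8 * Real.exp (3 * r)) * 14 ≤ 1 - θ * (8 * Real.exp (3 * κ)) * (∑ l ∈ Finset.range 3, (1 / lam) ^ l) / lam := by linarith
  have hnum1 : (Fsrc + sD) * (8 * Real.exp (3 * κ)) * (∑ l ∈ Finset.range 3, (1 / lam) ^ l) / lam ≤ (Fsrc + sD) * (8 * Real.exp (3 * r)) * 14 := by
    rw [mul_div_assoc]
    exact mul_le_mul (mul_le_mul_of_nonneg_left hCg_le (by positivity)) hSl (by positivity) (by positivity)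
  have hC₃ : Real.sqrt (3 ^ 3 / (c₀ * ((F.L : ℝ) ^ (K - n)) ^ 3) * (lam ^ 3)⁻¹) ≤ Real.sqrt (3 ^ 3 * 8 / (c₀ * ((F.L : ℝ) ^ (K - n)) ^ 3)) := by
    refine Real.sqrt_le_sqrt ?_
    have hL : 0 < c₀ * ((F.L : ℝ) ^ (K - n)) ^ 3 := by
      have : (0 : ℝ) < (F.L : ℝ) ^ (K - n) := pow_pos (by exact_mod_cast (F.P K).L_pos) _
      positivity
    have hl3 : (lam ^ 3)⁻¹ ≤ 8 := by
      rw [inv_le_comm₀ (by positivity) (by norm_num)]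
      nlinarith [pow_le_pow_left₀ (by norm_num : (0 : ℝ) ≤ 1 / 2) hlam 3]
    calc 3 ^ 3 / (c₀ * ((F.L : ℝ) ^ (K - n)) ^ 3) * (lam ^ 3)⁻¹ ≤ 3 ^ 3 / (c₀ * ((F.L : ℝ) ^ (K - n)) ^ 3) * 8 :=
          mul_le_mul_of_nonneg_left hl3 (by positivity)
      _ = 3 ^ 3 * 8 / (c₀ * ((F.L : ℝ) ^ (K - n)) ^ 3) := by ring
  have hEWle : EW ≤ Real.sqrt (8 * Real.exp (3 * r) * (2 * (1 + 1 / r)) ^ 3) * D₀ := by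
    rw [hEWdef]
    refine mul_le_mul_of_nonneg_right (Real.sqrt_le_sqrt ?_) hD₀
    have h8 : (1 / 8 * Real.exp (-(3 * κ)))⁻¹ = 8 * Real.exp (3 * κ) := by
      rw [mul_inv, Real.exp_neg, inv_inv]; norm_num
    rw [h8]
    have hrat : 1 / (2 * r - κ) ≤ 1 / r := one_div_le_one_div_of_le hr (by linarith)
    have h2rκ : 0 < 2 * r - κ := by linarith
    have hb0 : 0 ≤ 2 * (1 + 1 / (2 * r - κ)) := mul_nonneg zero_le_two (add_nonneg zero_le_one (div_nonneg zero_le_one h2rκ.le))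
    have hb : (2 * (1 + 1 / (2 * r - κ))) ^ 3 ≤ (2 * (1 + 1 / r)) ^ 3 := pow_le_pow_left₀ hb0 (by linarith) 3
    exact mul_le_mul hCg_le hb (pow_nonneg hb0 3) (by positivity)
  have hnum2 : Real.sqrt (3 ^ 3 / (c₀ * ((F.L : ℝ) ^ (K - n)) ^ 3) * (lam ^ 3)⁻¹) * EW
      ≤ Real.sqrt (3 ^ 3 * 8 / (c₀ * ((F.L : ℝ) ^ (K - n)) ^ 3)) * (Real.sqrt (8 * Real.exp (3 * r) * (2 * (1 + 1 / r)) ^ 3) * D₀) :=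
    mul_le_mul hC₃ hEWle hEW0 (Real.sqrt_nonneg _)
  have hnum0 : 0 ≤ (Fsrc + sD) * (8 * Real.exp (3 * κ)) * (∑ l ∈ Finset.range 3, (1 / lam) ^ l) / lam
      + Real.sqrt (3 ^ 3 / (c₀ * ((F.L : ℝ) ^ (K - n)) ^ 3) * (lam ^ 3)⁻¹) * EW := by
    refine add_nonneg ?_ (mul_nonneg (Real.sqrt_nonneg _) hEW0)
    rw [mul_div_assoc]
    exact mul_nonneg (mul_nonneg (add_nonneg hFsrc hsD) (by positivity)) (div_nonneg hS0 hlam0.le)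
  exact div_le_div₀ (by linarith [hnum0, hnum1, hnum2]) (add_le_add hnum1 hnum2) hden hden'

end Summit.QuantumFields.YangMills.Theorems.Prop7OneFormPointwiseDecayKnit

end
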